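import Mathlib

/-!
# The block matrices of Lemma B3.6 / B4.4 are invertible

Blind cell `pub-hodge-repro2`, seat p1 (Tier 4, sub-claim B4).

T4-B4-p1.md Lemma B4.4 (= TIER4 v0.9 Lemma B3.6, «induced types split») uses, for a CM field `M̃ ⊃ K`
with `r := [M̃ : K]`, a `K`-basis `b_1, …, b_r` of `M̃` and an embedding `σ : K → ℂ`, the `r × r` matrix
`C_σ := (θ(b_j))_{θ, j}` indexed by the `r` embeddings `θ : M̃ → ℂ` extending `σ`, and the fact that
`C_σ` is invertible — «`(det C_σ)² = σ(disc_{M̃/K}(b_1,…,b_r)) ≠ 0`».  This file is that fact in Lean: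
Mathlib's `Algebra.discr_eq_det_embeddingsMatrixReindex_pow_two` (the discriminant is the square of the
determinant of the embeddings matrix) and `Algebra.discr_not_zero_of_basis` (the discriminant of a
basis of a finite separable extension is non-zero), applied with `ℂ` made a `K`-algebra through `σ`
(so that the `K`-algebra homomorphisms `M̃ →ₐ[K] ℂ` are exactly the embeddings extending `σ`).

* `det_embeddingsMatrixReindex_ne_zero` — the general statement (any finite separable `L/K`, any
  algebraically closed `K`-algebra `E`).
* `exists_equiv_algHom` — the index set has the right size: `|L →ₐ[K] E| = [L : K]`.
* `det_embeddingsMatrix_of_ringHom_ne_zero` — the form used in Lemma B4.4: `E = ℂ` with the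
  `K`-algebra structure `σ.toAlgebra` for an arbitrary embedding `σ : K →+* ℂ`.
-/

namespace Summit.Ventures.HodgeRepro2

open scoped Classical

section General

variable {ι : Type*} [Fintype ι] (K : Type*) {L : Type*} (E : Type*) [Field K] [Field L] [Field E]
  [Algebra K L] [Algebra K E] [IsAlgClosed E] [Module.Finite K L] [Algebra.IsSeparable K L]

/-- The embeddings matrix `(θ(b_j))_{θ, j}` of a basis `b` of a finite separable extension `L/K`, with
the `[L:K]` embeddings `θ : L →ₐ[K] E` into an algebraically closed `K`-algebra `E`, has non-zero
determinant (its square is the image of the discriminant of `b`). -/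
theorem det_embeddingsMatrixReindex_ne_zero (b : Module.Basis ι K L) (e : ι ≃ (L →ₐ[K] E)) :
    (Algebra.embeddingsMatrixReindex K E (⇑b) e).det ≠ 0 := by
  intro h
  have h2 := Algebra.discr_eq_det_embeddingsMatrixReindex_pow_two K E (⇑b) e
  rw [h, zero_pow two_ne_zero] at h2
  have h3 : Algebra.discr K ⇑b = 0 := (algebraMap K E).injective (by simpa using h2)
  exact Algebra.discr_not_zero_of_basis K b h3

/-- There are exactly `[L : K]` embeddings `L →ₐ[K] E`, so they can be indexed by the basis. -/
theorem exists_equiv_algHom (b : Module.Basis ι K L) : Nonempty (ι ≃ (L →ₐ[K] E)) := by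
  have h1 : Fintype.card ι = Module.finrank K L := (Module.finrank_eq_card_basis b).symm
  have h2 : Fintype.card (L →ₐ[K] E) = Module.finrank K L := AlgHom.card K L E
  exact ⟨Fintype.equivOfCardEq (h1.trans h2.symm)⟩

end General

section Complex

variable {ι : Type*} [Fintype ι] {K L : Type*} [Field K] [Field L] [Algebra K L]
  [Module.Finite K L] [Algebra.IsSeparable K L]

/-- **Lemma B4.4's block matrix.** For an embedding `σ : K →+* ℂ`, make `ℂ` a `K`-algebra through
`σ`; then the `K`-algebra homomorphisms `L →ₐ[K] ℂ` are the embeddings `θ : L → ℂ` extending `σ`, and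
the matrix `(θ(b_j))_{θ, j}` for a `K`-basis `b` of `L` is invertible. -/
theorem det_embeddingsMatrix_of_ringHom_ne_zero (σ : K →+* ℂ) (b : Module.Basis ι K L) :
    letI : Algebra K ℂ := σ.toAlgebra
    ∀ e : ι ≃ (L →ₐ[K] ℂ), (Algebra.embeddingsMatrixReindex K ℂ (⇑b) e).det ≠ 0 := by
  letI : Algebra K ℂ := σ.toAlgebra
  intro e
  exact det_embeddingsMatrixReindex_ne_zero K ℂ b e

omit [Module.Finite K L] [Algebra.IsSeparable K L] in
/-- The extensions of `σ` to `L` are exactly the `K`-algebra maps for the `σ`-structure: an embedding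
`θ : L →+* ℂ` restricts to `σ` on `K` iff it is `K`-linear for `σ.toAlgebra`. -/
theorem comp_algebraMap_eq_iff (σ : K →+* ℂ) (θ : L →+* ℂ) :
    letI : Algebra K ℂ := σ.toAlgebra
    θ.comp (algebraMap K L) = σ ↔ ∀ x : K, θ (algebraMap K L x) = algebraMap K ℂ x := by
  letI : Algebra K ℂ := σ.toAlgebra
  constructor
  · intro h x
    have := congrArg (fun f : K →+* ℂ => f x) h
    simpa [RingHom.algebraMap_toAlgebra] using this
  · intro h
    ext x
    simpa [RingHom.algebraMap_toAlgebra] using h x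

end Complex

end Summit.Ventures.HodgeRepro2
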